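import Mathlib
import HarnessLib
import Literature.AlgebraicGeometry.Resolution.BlowupPrincipalCharts

/-!
# S1a — TRANSITION BETWEEN TWO PRINCIPAL CHARTS OF A BLOWING UP: the pinned ratio `y₀/y₁` is a unit on `X′[U, y₁] ∩ X′[U, y₀]`

[OURS · L1 W4.5c · lead-1 g12; folklore chart-transition fact, in the tree's `blowupChart` language (Literature `BlowupPrincipalCharts`)] — NOT a statement of
the manuscript; counted 0; AI-level work, weaker than expert review. Crux stmt-ResolutionOfSingularities-17941 `CyclicQuotientFourfolds`, line `s1a-logminvertex` v13
(used by I-2 move 2: the zero set of the E-free pinned residual section `z₀` (`z₀ · π^*y₁ = π^*y₀`) of the norm chart misses the other chart, whence it is closed).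

* `appLE_mem_nonZeroDivisors_of_le_blowupChart`, `eq_of_mul_appLE_eq` — on (an open inside) the principal chart `X′[U, y₁]` the pulled-back generator `π^*y₁` is a
  nonzerodivisor on every affine open, so a section is DETERMINED by a pin `z · π^*y₁ = π^*y₀` (E-free interfaces are sound);
* ★ `mem_basicOpen_of_mem_blowupChart_of_mul_appLE_eq` — if `z · π^*y₁ = π^*y₀` on an open `W ⊆ X′[U, y₁]`, then every point of `W ∩ X′[U, y₀]` lies in `D(z)`.
-/

set_option linter.dupNamespace false

noncomputable section

universe u

open CategoryTheory AlgebraicGeometry TopologicalSpace Opposite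
open Literature.AlgebraicGeometry.Resolution

namespace Summit.ResolutionOfSingularities.ResolutionOfSingularities.Theorems.WildQuotientResolution.S1.BlowupCharts

variable {X' X : Scheme.{u}} {π : X' ⟶ X} {I : X.IdealSheafData} (hπ : IsBlowup π I) (U : X.affineOpens)

include hπ in
/-- On an affine open inside the principal chart `X′[U, y₁]`, the pulled-back section `π^*y₁` is a nonzerodivisor. [folklore; Stacks 02OS] -/
theorem appLE_mem_nonZeroDivisors_of_le_blowupChart {y₁ : Γ(X, U)} (hy₁ : y₁ ∈ I.ideal U) (W : X'.affineOpens)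
    (hW : (W : X'.Opens) ≤ blowupChart π I U y₁) :
    π.appLE U W (hW.trans (blowupChart_le_preimage π I U y₁)) y₁ ∈ nonZeroDivisors Γ(X', W) := by
  obtain ⟨h, hnzd, -⟩ := (hπ.isPrincipalChart_blowupChart hy₁).of_le (W' := W) hW
  exact hnzd

include hπ in
/-- **Pins determine sections**: two sections of an affine open inside `X′[U, y₁]` with the same multiple of `π^*y₁` are equal. [folklore] -/
theorem eq_of_mul_appLE_eq {y₁ : Γ(X, U)} (hy₁ : y₁ ∈ I.ideal U) (W : X'.affineOpens) (hW : (W : X'.Opens) ≤ blowupChart π I U y₁)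
    {z z' : Γ(X', W)} (h : z * π.appLE U W (hW.trans (blowupChart_le_preimage π I U y₁)) y₁ = z' * π.appLE U W (hW.trans (blowupChart_le_preimage π I U y₁)) y₁) :
    z = z' := by
  have hnzd := appLE_mem_nonZeroDivisors_of_le_blowupChart hπ U hy₁ W hW
  have h0 : (z - z') * π.appLE U W (hW.trans (blowupChart_le_preimage π I U y₁)) y₁ = 0 := by rw [sub_mul, h, sub_self]
  exact sub_eq_zero.mp ((mem_nonZeroDivisors_iff_right.mp hnzd) _ h0)

include hπ in
/-- ★ **The pinned ratio `z = y₀/y₁` is a unit on `X′[U, y₁] ∩ X′[U, y₀]`**: if `z · π^*y₁ = π^*y₀` on an open `W ⊆ X′[U, y₁]`, then every point of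
`W ∩ X′[U, y₀]` lies in the basic open `D(z)`. [OURS · L1 W4.5c; folklore] -/
theorem mem_basicOpen_of_mem_blowupChart_of_mul_appLE_eq {y₀ y₁ : Γ(X, U)} (hy₁ : y₁ ∈ I.ideal U)
    {W : X'.Opens} (hW : W ≤ blowupChart π I U y₁) (z : Γ(X', W))
    (hz : z * π.appLE U W (hW.trans (blowupChart_le_preimage π I U y₁)) y₁ = π.appLE U W (hW.trans (blowupChart_le_preimage π I U y₁)) y₀)
    {v : X'} (hvW : v ∈ W) (hv₀ : v ∈ blowupChart π I U y₀) : v ∈ X'.basicOpen z := by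
  -- a small affine neighbourhood of `v` inside `W`, principal for `y₀` and for `y₁`
  obtain ⟨W', hW'pc, hvW', hW'le⟩ := exists_isPrincipalChart_le_of_mem (π := π) (I := I) (U := U) (g := y₀) hv₀ (O := W) hvW
  have h₁ : IsPrincipalChart π I U y₁ W' := (hπ.isPrincipalChart_blowupChart hy₁).of_le (W' := W') (hW'le.trans hW)
  obtain ⟨h', hnzd, -⟩ := h₁
  -- `π^*y₁ = c · π^*y₀` on `W'`
  obtain ⟨c, hc⟩ := hW'pc.exists_eq_mul (s := y₁) hy₁
  -- restrict the pin to `W'`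
  have hz' : X'.presheaf.map (homOfLE hW'le).op z * π.appLE U W' h' y₁ = π.appLE U W' h' y₀ := by
    have := congrArg (X'.presheaf.map (homOfLE hW'le).op) hz
    rw [map_mul, map_appLE_eq (hW.trans (blowupChart_le_preimage π I U y₁)) hW'le y₁,
      map_appLE_eq (hW.trans (blowupChart_le_preimage π I U y₁)) hW'le y₀] at this
    exact this
  -- `(1 - c z') · π^*y₁ = 0`, so `c z' = 1`
  have hcz : c * X'.presheaf.map (homOfLE hW'le).op z = 1 := by
    have h0 : (1 - c * X'.presheaf.map (homOfLE hW'le).op z) * π.appLE U W' h' y₁ = 0 := by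
      rw [sub_mul, one_mul, mul_assoc, hz', ← hc, sub_self]
    have := (mem_nonZeroDivisors_iff_right.mp hnzd) _ h0
    rw [sub_eq_zero] at this
    exact this.symm
  have hunit : IsUnit (X'.presheaf.map (homOfLE hW'le).op z) := by rw [mul_comm] at hcz; exact IsUnit.of_mul_eq_one _ hcz
  have hD : X'.basicOpen (X'.presheaf.map (homOfLE hW'le).op z) = (W' : X'.Opens) := X'.basicOpen_of_isUnit hunit
  rw [Scheme.basicOpen_res] at hD
  have : v ∈ (W' : X'.Opens) ⊓ X'.basicOpen z := by rw [hD]; exact hvW'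
  exact this.2

end Summit.ResolutionOfSingularities.ResolutionOfSingularities.Theorems.WildQuotientResolution.S1.BlowupCharts

end
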